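/-
Copyright (c) 2026 the pub-hodgecm-mathlib formalisation cell (harness21).  Prover seat hodgecm-mathlib-F0P2-p11 (g2) (L1; LEAD F0P6-plan (g14) «(o1) KIND 1», memo
`CENSUS-K1-DealTable` ADDENDUM 2 step (c)), Track B «K2-LIT» ∕ hLiu418 #184♮, ROAD Φ, G5-b: THE MIDDLE WEYL ELEMENT CONJUGATES THE UPPER BOREL OF THE LEVI INTO `P_Δ(𝔸)` —
`w₀ · Λ b · w₀ ∈ P_Δ(𝔸) ⟺ b₁₀ = 0` for ADELIC `b ∈ GL₂(𝔸_L)`, and the section law `f(w₀ · Λ b · x) = σ(w₀ Λ b w₀) · f(w₀ · x)`.  THEOREMS ONLY.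
-/
import Summits.HodgeConjecture.HodgeConjecture.Theorems.K2LiuSiegelMiddleCellLeviCriterion   -- ★ `isSiegelDelta_reflStd_conj_levi_unip_iff`, `reflStd_mul_self`, `exists_gramR_eq_diagonal`
import HarnessLib

/-!
# Crux `HLiu418`, KIND 1, (K1b-W) route step (c): `w₀ · Λ(b) · w₀ ∈ P_Δ(𝔸)` for upper-triangular ADELIC `b`, and the translate law for Siegel sections

Cell `hodgecm-mathlib`, crux item hLiu418 = `stmt-HodgeConjecture-24832` (helper lane, count-neutral); squad K2 ∕ K2Liu, LEAD F0P6-plan (g14); prover F0P2-p11 (g2).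
THEOREMS ONLY (no `def`, no `instance`, no notation, no named-fact hypothesis, no `sorry`).

WHY (memo `CENSUS-K1-DealTable` ADDENDUM 2, route step (c)).  After ★ p862785 the K1-b♮ line term is `C • whittakerDelta⁽ᴮ⁾ (…) (f_s (blkD (1,·) · g)) 1` with a translate
`g = Λ(ĝ m₀) ∈ Λ(GL₂(𝔸_L))` (Iwasawa of `h` in `H(𝔸)`).  Writing `ĝ m₀ = b · k₂` (Iwasawa of `GL₂(𝔸_L)` w.r.t. the UPPER Borel) the compact part is absorbed by
`K`-finiteness and the Borel part EXITS TO THE LEFT through the middle Weyl element: ★ `isSiegelDelta_reflStd_conj_levi_unip_iff` (adelic frame criterion of ★ `K2LiuSiegelMiddleCellLeviCriterion`)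
specialised at `u = 1` says `w₀ Λ(x) w₀ ∈ P_Δ(𝔸) ⟺ x₁₀ = 0 ∧ (x♯)₀₁ = 0`, and for upper-triangular `x` the co-block `x♯ = T⁻¹(x̄⁻¹)ᵀT` (`T` diagonal) is lower triangular.
* §1 `inv_apply_one_zero_of_comm` — over a commutative ring, `b₁₀ = 0 ⇒ (b⁻¹)₁₀ = 0` for `b ∈ GL₂` (adjugate formula).
* §2 **`isSiegelDelta_reflStd_conj_levi_iff_upper`** — `IsSiegelDelta (w₀ · Λ b · w₀) ↔ b₁₀ = 0` for `b ∈ GL₂(𝔸_L)` (the rational case is ★ `isSiegelDelta_reflStd_conj_levi_map_iff`).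
* §3 **`apply_reflStd_levi_upper`** — for a Siegel section `f ∈ I_Δ(s, χ)` and upper-triangular `b`: `f (w₀ · Λ b · x) = σ_{χ,s}(w₀ Λ b w₀) · f (w₀ · x)` (`w₀² = 1` ★ `reflStd_mul_self`).
HONEST LABEL.  Count-neutral helper; `HC_CM` is proved only modulo the 7 printed citations (2 remaining named inputs: hLiu418 = `stmt-HodgeConjecture-24832`,
h413 = `stmt-HodgeConjecture-24833`) until rung 0 closes.

## References
* [MoeglinWaldspurger1995] C. Mœglin, J.-L. Waldspurger, CUP (1995), II.1.7 (the parabolic `M ∩ w⁻¹Pw`).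
* [KudlaRallis1994] S. Kudla, S. Rallis, Ann. of Math. 140 (1994), §2.
* [GelbartPiatetskishapiroRallis1987] LNM 1254 (1987), Part A §§1–2.
-/

set_option autoImplicit false
set_option linter.dupNamespace false -- the mandated namespace repeats `HodgeConjecture.HodgeConjecture`

noncomputable section

open scoped Matrix
open NumberField IsDedekindDomain
open Literature.NumberTheory.Automorphic Literature.NumberTheory.Automorphic.UnitaryGroup Literature.NumberTheory.GaloisRepresentations
open Literature.NumberTheory.GelbartRogawski1991 Literature.NumberTheory.GelbartRogawski1991.GRConstruction
open Literature.NumberTheory.GelbartRogawski1991.AdaptedBlocks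
open Literature.NumberTheory.K2Lit.SiegelDoubled
open UnitaryDualPair

namespace Summit.HodgeConjecture.HodgeConjecture.Cruxes.HLiu418.K2LiuReflStdConjLeviUpper

open K2LiuSiegelUnipotentFourierDefs K2LiuSiegelMiddleCellLeviCriterion K2LiuSiegelRationalLeviDecomposition

/-! ## §1 Inverses of upper-triangular `2 × 2` matrices over a commutative ring -/

/-- over a commutative ring the inverse of an upper-triangular invertible `2 × 2` matrix is upper triangular (adjugate formula). [folklore] -/
theorem inv_apply_one_zero_of_comm {R : Type*} [CommRing R] {b : GL (Fin 2) R} (hb : (b : Matrix (Fin 2) (Fin 2) R) 1 0 = 0) :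
    ((b⁻¹ : GL (Fin 2) R) : Matrix (Fin 2) (Fin 2) R) 1 0 = 0 := by
  rw [Matrix.coe_units_inv, Matrix.inv_def, Matrix.adjugate_fin_two, Matrix.smul_apply, smul_eq_mul]
  simp [hb]

/-! ## §2 `w₀ · Λ b · w₀ ∈ P_Δ(𝔸) ⟺ b` upper triangular -/

variable (L : Type) [Field L] [NumberField L] [IsCMField L]
variable {N M : ℕ} (e : Fin N × Fin M ≃ Fin 2)
  (dV : Fin N → L) (hdV : ∀ i, IsCMField.complexConj L (dV i) = dV i)
  (dW : Fin M → L) (hdW : ∀ i, IsCMField.complexConj L (dW i) = dW i)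

variable {g₀ : UnitaryGroup.rationalPair (Fp L) L (IsCMField.complexConj L) N M (Matrix.diagonal dV) (Matrix.diagonal dW)}
  (hg₀ : ((g₀ : GL (Fin N × Fin M) L) : Matrix (Fin N × Fin M) (Fin N × Fin M) L) = Matrix.diagonal (fun k => 1 - 2 * (![0, 1] : Fin 2 → L) (e k)))
  (Λ : GL (Fin 2) (AdeleRing (𝓞 L) L) →* HA L e dV hdV dW hdW)
  (hΛ : ∀ g : GL (Fin 2) (AdeleRing (𝓞 L) L), blk L e dV hdV dW hdW (Λ g) =
    cayR (AdeleRing (𝓞 L) L) (Fin 2) * Matrix.fromBlocks (g : Matrix (Fin 2) (Fin 2) (AdeleRing (𝓞 L) L)) 0 0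
      (((gramR L e dV hdV dW hdW).map ((algebraMap L (AdeleRing (𝓞 L) L)).comp (algebraMap (Fp L) L)))⁻¹ *
        (((g⁻¹ : GL (Fin 2) (AdeleRing (𝓞 L) L)) : Matrix (Fin 2) (Fin 2) (AdeleRing (𝓞 L) L)).map
          (conjAdele (Fp L) L (IsCMField.complexConj L)))ᵀ *
        (gramR L e dV hdV dW hdW).map ((algebraMap L (AdeleRing (𝓞 L) L)).comp (algebraMap (Fp L) L))) *
      cayRinv (AdeleRing (𝓞 L) L) (Fin 2))

include hg₀ hΛ in
/-- **`w₀ · Λ b · w₀ ∈ P_Δ(𝔸) ⟺ b₁₀ = 0`** for ADELIC `b ∈ GL₂(𝔸_L)`: the adelic frame criterion ★ `isSiegelDelta_reflStd_conj_levi_unip_iff` at `u = 1`; for upper-triangular `b` the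
co-block `b♯ = T⁻¹(b̄⁻¹)ᵀT` (`T` diagonal ★ `exists_gramR_eq_diagonal`) is lower triangular (§1), so its `(0,1)` entry vanishes.
[cite: MoeglinWaldspurger1995, II.1.7] [cite: KudlaRallis1994, §2] -/
theorem isSiegelDelta_reflStd_conj_levi_iff_upper (b : GL (Fin 2) (AdeleRing (𝓞 L) L)) :
    IsSiegelDelta L e dV hdV dW hdW
        (iotaGG L e dV hdV dW hdW (1, UnitaryGroup.rationalPairToAdelic (Fp L) L (IsCMField.complexConj L) N M (Matrix.diagonal dV) (Matrix.diagonal dW) g₀) *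
          Λ b *
          iotaGG L e dV hdV dW hdW (1, UnitaryGroup.rationalPairToAdelic (Fp L) L (IsCMField.complexConj L) N M (Matrix.diagonal dV) (Matrix.diagonal dW) g₀)) ↔
      (b : Matrix (Fin 2) (Fin 2) (AdeleRing (𝓞 L) L)) 1 0 = 0 := by
  have h := isSiegelDelta_reflStd_conj_levi_unip_iff L e dV hdV dW hdW hg₀ Λ hΛ b (one_mem (unipDelta L e dV hdV dW hdW))
  rw [mul_one, blk_one, ← Matrix.fromBlocks_one, Matrix.toBlocks_fromBlocks₁₂, Matrix.mul_zero, Matrix.zero_apply] at h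
  rw [h]
  constructor
  · exact fun h' => h'.1.1
  · intro hb
    refine ⟨⟨hb, ?_⟩, rfl⟩
    obtain ⟨t, ht⟩ := exists_gramR_eq_diagonal L e dV hdV dW hdW
    rw [ht, Matrix.diagonal_map (map_zero _), Matrix.inv_diagonal, Matrix.mul_diagonal, Matrix.diagonal_mul, Matrix.transpose_apply, Matrix.map_apply,
      inv_apply_one_zero_of_comm hb, map_zero, mul_zero, zero_mul]

/-! ## §3 The translate law for Siegel sections -/

include hg₀ hΛ in
/-- **`f (w₀ · Λ b · x) = σ_{χ,s}(w₀ Λ b w₀) · f (w₀ · x)`** for a Siegel section `f ∈ I_Δ(s, χ)` and upper-triangular adelic `b` (`w₀² = 1` ★ `reflStd_mul_self`, §2): an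
upper-triangular Levi translate EXITS TO THE LEFT of the middle Weyl element as a scalar. [cite: MoeglinWaldspurger1995, II.1.7] [cite: KudlaRallis1994, §2] -/
theorem apply_reflStd_levi_upper {χ : HeckeCharacter L} {s : ℂ} {f : HA L e dV hdV dW hdW → ℂ} (hf : IsSiegelDeltaSection L e dV hdV dW hdW χ s f)
    (b : GL (Fin 2) (AdeleRing (𝓞 L) L)) (hb : (b : Matrix (Fin 2) (Fin 2) (AdeleRing (𝓞 L) L)) 1 0 = 0) (x : HA L e dV hdV dW hdW) :
    f (iotaGG L e dV hdV dW hdW (1, UnitaryGroup.rationalPairToAdelic (Fp L) L (IsCMField.complexConj L) N M (Matrix.diagonal dV) (Matrix.diagonal dW) g₀) * Λ b * x) =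
      siegelDeltaCharacter L e dV hdV dW hdW χ s
          (iotaGG L e dV hdV dW hdW (1, UnitaryGroup.rationalPairToAdelic (Fp L) L (IsCMField.complexConj L) N M (Matrix.diagonal dV) (Matrix.diagonal dW) g₀) * Λ b *
            iotaGG L e dV hdV dW hdW (1, UnitaryGroup.rationalPairToAdelic (Fp L) L (IsCMField.complexConj L) N M (Matrix.diagonal dV) (Matrix.diagonal dW) g₀)) *
        f (iotaGG L e dV hdV dW hdW (1, UnitaryGroup.rationalPairToAdelic (Fp L) L (IsCMField.complexConj L) N M (Matrix.diagonal dV) (Matrix.diagonal dW) g₀) * x) := by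
  have hw := reflStd_mul_self L e dV hdV dW hdW hg₀
  have hP := (isSiegelDelta_reflStd_conj_levi_iff_upper L e dV hdV dW hdW hg₀ Λ hΛ b).2 hb
  have heq : iotaGG L e dV hdV dW hdW (1, UnitaryGroup.rationalPairToAdelic (Fp L) L (IsCMField.complexConj L) N M (Matrix.diagonal dV) (Matrix.diagonal dW) g₀) * Λ b * x =
      (iotaGG L e dV hdV dW hdW (1, UnitaryGroup.rationalPairToAdelic (Fp L) L (IsCMField.complexConj L) N M (Matrix.diagonal dV) (Matrix.diagonal dW) g₀) * Λ b *
          iotaGG L e dV hdV dW hdW (1, UnitaryGroup.rationalPairToAdelic (Fp L) L (IsCMField.complexConj L) N M (Matrix.diagonal dV) (Matrix.diagonal dW) g₀)) *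
        (iotaGG L e dV hdV dW hdW (1, UnitaryGroup.rationalPairToAdelic (Fp L) L (IsCMField.complexConj L) N M (Matrix.diagonal dV) (Matrix.diagonal dW) g₀) * x) := by
    rw [← mul_assoc, mul_assoc (_ * Λ b), hw, mul_one]
  rw [heq, hf _ hP]

end Summit.HodgeConjecture.HodgeConjecture.Cruxes.HLiu418.K2LiuReflStdConjLeviUpper

end
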